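import Literature.NumberTheory.LFunctions.ConreyIwaniec2002AFEWeightDefs
import Literature.NumberTheory.LFunctions.ConreyIwaniec2002AFEKernelBounds
import Literature.NumberTheory.LFunctions.ConreyIwaniec2002Prop81TailIntegral
import HarnessLib

/-!
# Conrey–Iwaniec (2002), §8 (8.5)–(8.9): the three-range decomposition of `B(s)` and `A(s) − N(s)`

B. Conrey, H. Iwaniec, *Spacing of zeros of Hecke L-functions and the class number problem*,
Acta Arith. 103 (2002), §7 (7.12), (7.21)–(7.23); §8 (8.5)–(8.9) [held text
`paper:arxiv-math_0111012`, p0017–p0018].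

The first sum `A(s) = Σ_n λ(n) V_s(n/Q) n^{−s}` of the approximate functional equation (7.12) is an
absolutely convergent series on `Re s = ½` (`|V_s(y)| ≪ (1 + y/|s|)^{−6}`, Lemma 7.2, the tree's
`afeV_bounds`; `|λ(n)| ≤ d(n)`), and §8 splits it — and the divided difference
`B(s) = (A(s) − A(s′))/(s − s′)` — into three ranges: `n ≤ q⁴`, `q⁴ < n < 2T` and `n > T`, the
last two overlapping through the smooth partition `1 = (1 − η(n/T − 1)) + η(n/T − 1)`
(`η = Real.smoothTransition`). This file proves the bookkeeping identities in the exact shape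
consumed by the weighted mean-value theorems of §5 (`WeightedMeanValue.weighted_discreteMeanValue`,
`…_integral_tsum`):
* `summable_term_afeA`, `afeA_eq_tsum` — absolute convergence on `Re s = ½`, `|Im s| ≥ 1`;
* `afeA_dividedDiff_eq_tsum` — `B(s) = Σ_n λ(n)n^{−1/2}·Ω_{t,t′}(log n)·n^{−it}` (termwise
  identity `afeVlog_mul_cpow_sub` of `ConreyIwaniec2002AFEWeightDefs`);
* `tsum_split_three` — `Σ' X = Σ_{n≤N₁} X + Σ_{n≤N₂} p₂X + Σ' p₃X` for a partition `1 = 𝟙_{≤N₁} + p₂ + p₃`;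
* `afeA_dividedDiff_split`, `afeA_sub_shortLSum_split` — (8.5) and (8.8)–(8.9) as sums of three
  pieces with window factors `Θ_j(log n) = 1` inserted;
* `tail_coeff_summable`, `tail_coeff_sq_summable_le`, `tsum_tail_coeff_cpow_eq_LSeries` — the
  coefficients `a_n = a(n)λ(n)n^{−1/2}` of the long range (`a = tailCutoff c₀ q T`) are summable,
  `Σ(1 + n/T)|a_n|² ≤ (2c₀²/T)·Σ_n (1+n/qT)^{−8}d(n)²`, and `Σ_n a_n n^{−iτ}` is the `L`-series
  `Σ a(n)λ(n)n^{−1/2−iτ}` of Proposition 6.4.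
Everything PROVED; no definition.

«The programme SEARCHES and TYPES; no claim about Landau–Siegel zeros until a kernel theorem says so.»

## References
* [ConreyIwaniec2002] B. Conrey, H. Iwaniec, Acta Arith. 103 (2002) 259–312, arXiv:math/0111012:
  §7 (7.12), (7.21)–(7.23), Lemma 7.2; §8 (8.5)–(8.9).
-/

noncomputable section

open scoped NumberField
open Complex

namespace Literature.NumberTheory.LFunctions

namespace ConreyIwaniec2002

open NumberField

/-! ## §1. Absolute convergence of `A(s)` on the critical line -/

/-- `((1 + y)^k)⁻¹ ≤ (y^k)⁻¹` for `y > 0`. [cite: ConreyIwaniec2002, Lemma 7.2 (7.16)] -/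
theorem inv_one_add_pow_le {y : ℝ} (hy : 0 < y) (k : ℕ) : ((1 + y) ^ k)⁻¹ ≤ (y ^ k)⁻¹ :=
  inv_anti₀ (pow_pos hy k) (pow_le_pow_left₀ hy.le (by linarith) k)

/-- **The terms of `A(s)` on `Re s = ½`**: if `|V_s(n/Q)| ≤ C(1 + n/(Q‖s‖))^{−6}` and
`|λ(n)| ≤ d(n)` then `|λ(n)V_s(n/Q)n^{−s}| ≤ C(Q‖s‖)⁶ · d(n) n^{−13/2}`.
[cite: ConreyIwaniec2002, Lemma 7.2 (7.16), §8 (8.5)] -/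
theorem norm_term_afeA_le {q : ℕ} (hq : 0 < q) {lam : ℕ → ℂ} {w : ℂ} (hw : w.re = 1 / 2)
    (hw0 : 0 < ‖w‖) {C : ℝ} (hC : 0 ≤ C)
    (hV : ∀ y : ℝ, 0 < y → ‖afeV w y‖ ≤ C * ((1 + y / ‖w‖) ^ 6)⁻¹)
    (hlam : ∀ n : ℕ, ‖lam n‖ ≤ n.divisors.card) (n : ℕ) :
    ‖LSeries.term (fun n => lam n * afeV w (n / condQ q)) w n‖ ≤
      C * (condQ q * ‖w‖) ^ 6 * ((n.divisors.card : ℝ) * (n : ℝ) ^ (-(13 / 2 : ℝ))) := by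
  have hQ : 0 < condQ q := condQ_pos hq
  rcases eq_or_ne n 0 with rfl | hn
  · simp [LSeries.term_zero]
  have hn0 : (0 : ℝ) < n := by exact_mod_cast Nat.pos_of_ne_zero hn
  rw [LSeries.term_of_ne_zero hn, norm_div, norm_mul,
    Complex.norm_natCast_cpow_of_pos (Nat.pos_of_ne_zero hn), hw]
  have hy : 0 < (n : ℝ) / condQ q := div_pos hn0 hQ
  have h1 := hV _ hy
  have hyw : 0 < (n : ℝ) / condQ q / ‖w‖ := div_pos hy hw0
  have h2 : ((1 + (n : ℝ) / condQ q / ‖w‖) ^ 6)⁻¹ ≤ (condQ q * ‖w‖) ^ 6 * (n : ℝ) ^ (-(6 : ℝ)) := by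
    refine (inv_one_add_pow_le hyw 6).trans (le_of_eq ?_)
    rw [Real.rpow_neg hn0.le, show (n : ℝ) ^ (6 : ℝ) = (n : ℝ) ^ (6 : ℕ) by
      exact_mod_cast Real.rpow_natCast (n : ℝ) 6, div_div, div_pow, inv_div, div_eq_mul_inv]
  have hrpow : (n : ℝ) ^ (-(6 : ℝ)) / (n : ℝ) ^ (1 / 2 : ℝ) = (n : ℝ) ^ (-(13 / 2 : ℝ)) := by
    rw [← Real.rpow_sub hn0]; norm_num
  calc ‖lam n‖ * ‖afeV w (n / condQ q)‖ / (n : ℝ) ^ (1 / 2 : ℝ)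
      ≤ n.divisors.card * (C * ((condQ q * ‖w‖) ^ 6 * (n : ℝ) ^ (-(6 : ℝ)))) /
          (n : ℝ) ^ (1 / 2 : ℝ) := by
        gcongr ?_ / _
        exact mul_le_mul (hlam n) (h1.trans (by gcongr)) (norm_nonneg _) (Nat.cast_nonneg _)
    _ = C * (condQ q * ‖w‖) ^ 6 * ((n.divisors.card : ℝ) *
          ((n : ℝ) ^ (-(6 : ℝ)) / (n : ℝ) ^ (1 / 2 : ℝ))) := by ring
    _ = _ := by rw [hrpow]

/-- **`A(s)` converges absolutely on `Re s = ½`, `|Im s| ≥ 1`** (class group characters of the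
imaginary quadratic field of discriminant `−q`). [cite: ConreyIwaniec2002, Lemma 7.2 (7.16), §8 (8.5)] -/
theorem summable_term_afeA {q : ℕ} [NeZero q] (hq4 : 4 < q) {χ : DirichletCharacter ℂ q}
    (hprim : χ.IsPrimitive) (hquad : χ.IsQuadratic) (hodd : χ.Odd)
    (K : Type) [Field K] [NumberField K] (h2 : Module.finrank ℚ K = 2)
    (hdisc : NumberField.discr K = -(q : ℤ)) (ψ : ClassGroup (𝓞 K) →* ℂˣ)
    {w : ℂ} (hw : w.re = 1 / 2) (him : 1 ≤ |w.im|) :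
    Summable fun n : ℕ =>
      LSeries.term (fun n => twistCount K (classGroupCharIdealHom ψ) n * afeV w (n / condQ q)) w n := by
  have hq : 0 < q := by omega
  obtain ⟨C, hC, hA, -⟩ := afeV_bounds
  have hw0 : 0 < ‖w‖ := by
    refine norm_pos_iff.mpr fun h => ?_
    rw [h] at him; simp at him; linarith
  have hV : ∀ y : ℝ, 0 < y → ‖afeV w y‖ ≤ C * ((1 + y / ‖w‖) ^ 6)⁻¹ := fun y hy =>
    (hA w y (by rw [hw]; norm_num) (by rw [hw]; norm_num) him hy).1
  have hlam := norm_twistCount_le_card_divisors hprim hquad hodd K h2 hdisc ψ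
  refine Summable.of_norm_bounded
    ((ZetaM4D.summable_card_divisors_mul_rpow (by norm_num : (1 : ℝ) < 13 / 2)).mul_left
      (C * (condQ q * ‖w‖) ^ 6)) (fun n => ?_)
  exact norm_term_afeA_le hq hw hw0 hC.le hV hlam n

/-- `A(s) = Σ' λ(n) V_s(n/Q) n^{−s}` as a `tsum` (the `L`-series term at `n = 0` vanishes since
`λ(0) = 0`). [cite: ConreyIwaniec2002, Proposition 7.1 (7.12)] -/
theorem afeA_eq_tsum (K : Type) [Field K] [NumberField K] (ψ : ClassGroup (𝓞 K) →* ℂˣ)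
    (q : ℕ) (w : ℂ) :
    afeA K ψ q w = ∑' n : ℕ, twistCount K (classGroupCharIdealHom ψ) n * afeV w (n / condQ q) *
      (n : ℂ) ^ (-w) := by
  unfold afeA LSeries
  congr 1
  funext n
  rw [LSeries.term_def₀ (by simp [twistCount_zero])]

/-! ## §2. The divided difference `B(s)` as a weighted Dirichlet series -/

/-- **`B(s) = (A(s) − A(s′))/(s − s′) = Σ_n λ(n)n^{−1/2}·Ω_{t,t′}(log n)·n^{−it}`** for
`s = ½+it`, `s′ = ½+it′`, `|t| ≥ 2`, `0 < |t − t′| ≤ 1` (absolutely convergent).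
[cite: ConreyIwaniec2002, §7 (7.21)–(7.23), §8 (8.5)] -/
theorem afeA_dividedDiff_eq_tsum {q : ℕ} [NeZero q] (hq4 : 4 < q) {χ : DirichletCharacter ℂ q}
    (hprim : χ.IsPrimitive) (hquad : χ.IsQuadratic) (hodd : χ.Odd)
    (K : Type) [Field K] [NumberField K] (h2 : Module.finrank ℚ K = 2)
    (hdisc : NumberField.discr K = -(q : ℤ)) (ψ : ClassGroup (𝓞 K) →* ℂˣ)
    {t t' : ℝ} (ht : 2 ≤ |t|) (htt' : t' ≠ t) (hdist : |t' - t| ≤ 1) :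
    (Summable fun n : ℕ => twistCount K (classGroupCharIdealHom ψ) n * (n : ℂ) ^ (-(1 / 2 : ℂ)) *
        afeOmega q t t' (Real.log n) * (n : ℂ) ^ (-((t : ℂ) * I))) ∧
    (afeA K ψ q (1 / 2 + t * I) - afeA K ψ q (1 / 2 + t' * I)) / ((t : ℂ) * I - t' * I) =
      ∑' n : ℕ, twistCount K (classGroupCharIdealHom ψ) n * (n : ℂ) ^ (-(1 / 2 : ℂ)) *
        afeOmega q t t' (Real.log n) * (n : ℂ) ^ (-((t : ℂ) * I)) := by
  set lam : ℕ → ℂ := fun n => twistCount K (classGroupCharIdealHom ψ) n with hlam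
  set d : ℂ := (t : ℂ) * I - t' * I with hd
  have htne : t ≠ t' := fun h => htt' h.symm
  have hne : d ≠ 0 := by
    rw [hd, ← sub_mul]
    refine mul_ne_zero ?_ I_ne_zero
    rw [sub_ne_zero]; exact fun h' => htne (by exact_mod_cast h')
  have ht'1 : 1 ≤ |t'| := by
    have h2 : |t| - |t'| ≤ |t - t'| := abs_sub_abs_le_abs_sub t t'
    rw [abs_sub_comm] at h2; linarith
  have hS := summable_term_afeA hq4 hprim hquad hodd K h2 hdisc ψ (w := 1 / 2 + t * I)
    (by simp) (by simp; linarith)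
  have hS' := summable_term_afeA hq4 hprim hquad hodd K h2 hdisc ψ (w := 1 / 2 + t' * I)
    (by simp) (by simpa using ht'1)
  have hlam0 : lam 0 = 0 := by simp [hlam, twistCount_zero]
  have hterm : ∀ (w : ℂ) (n : ℕ), LSeries.term (fun n => lam n * afeV w (n / condQ q)) w n =
      lam n * afeV w (n / condQ q) * (n : ℂ) ^ (-w) := fun w n =>
    LSeries.term_def₀ (by simp [hlam0]) w n
  -- the termwise identity
  have hpt : ∀ n : ℕ, LSeries.term (fun n => lam n * afeV (1 / 2 + t * I) (n / condQ q)) (1 / 2 + t * I) n -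
      LSeries.term (fun n => lam n * afeV (1 / 2 + t' * I) (n / condQ q)) (1 / 2 + t' * I) n =
      d * (lam n * (n : ℂ) ^ (-(1 / 2 : ℂ)) * afeOmega q t t' (Real.log n) * (n : ℂ) ^ (-((t : ℂ) * I))) := by
    intro n
    rcases eq_or_ne n 0 with rfl | hn
    · simp [hlam0]
    rw [hterm, hterm]
    have h := afeVlog_mul_cpow_sub q htne hn
    calc lam n * afeV (1 / 2 + t * I) (n / condQ q) * (n : ℂ) ^ (-(1 / 2 + (t : ℂ) * I)) -
          lam n * afeV (1 / 2 + t' * I) (n / condQ q) * (n : ℂ) ^ (-(1 / 2 + (t' : ℂ) * I))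
        = lam n * (afeV (1 / 2 + t * I) (n / condQ q) * (n : ℂ) ^ (-(1 / 2 + (t : ℂ) * I)) -
            afeV (1 / 2 + t' * I) (n / condQ q) * (n : ℂ) ^ (-(1 / 2 + (t' : ℂ) * I))) := by ring
      _ = lam n * (((t : ℂ) * I - t' * I) * afeOmega q t t' (Real.log n) *
            ((n : ℂ) ^ (-(1 / 2 : ℂ)) * (n : ℂ) ^ (-((t : ℂ) * I)))) := by rw [h]
      _ = _ := by rw [hd]; ring
  -- summability of the weighted series
  have hsumD : Summable fun n : ℕ =>
      d * (lam n * (n : ℂ) ^ (-(1 / 2 : ℂ)) * afeOmega q t t' (Real.log n) * (n : ℂ) ^ (-((t : ℂ) * I))) := by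
    have := hS.sub hS'
    refine this.congr fun n => hpt n
  have hsum : Summable fun n : ℕ =>
      lam n * (n : ℂ) ^ (-(1 / 2 : ℂ)) * afeOmega q t t' (Real.log n) * (n : ℂ) ^ (-((t : ℂ) * I)) := by
    have := hsumD.mul_left d⁻¹
    refine this.congr fun n => ?_
    rw [← mul_assoc, inv_mul_cancel₀ hne, one_mul]
  refine ⟨hsum, ?_⟩
  rw [div_eq_iff hne, afeA, afeA, LSeries, LSeries, ← Summable.tsum_sub hS hS', tsum_congr hpt, tsum_mul_left,
    mul_comm]

/-! ## §3. Splitting an absolutely convergent series into the three ranges -/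

/-- A `tsum` supported in `[1, N]` is a finite sum. [cite: ConreyIwaniec2002, §8 (8.5)] -/
theorem tsum_eq_sum_Icc_of_support {f : ℕ → ℂ} {N : ℕ} (h0 : f 0 = 0) (hN : ∀ n, N < n → f n = 0) :
    ∑' n : ℕ, f n = ∑ n ∈ Finset.Icc 1 N, f n := by
  rw [tsum_eq_sum (s := Finset.Icc 1 N)]
  intro n hn
  rw [Finset.mem_Icc, not_and_or, not_le, not_le] at hn
  rcases hn with h | h
  · have : n = 0 := by omega
    rw [this, h0]
  · exact hN n h

/-- **Three-range splitting**: if `X : ℕ → ℂ` is summable with `X 0 = 0`, and real weights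
`p₂, p₃` satisfy `p₂ n + p₃ n = 1` for `n > N₁`, `p₂ n = p₃ n… = 0`-pattern below (`p₃ = 0` on
`n ≤ N₁`, `p₂ = 0` on `n ≤ N₁` and on `n > N₂`, `|p₃| ≤ 1`), then
`Σ' X = Σ_{n ∈ [1,N₁]} X n + Σ_{n ∈ [1,N₂]} p₂(n) X n + Σ' p₃(n) X n`.
[cite: ConreyIwaniec2002, §8 (8.5)–(8.7)] -/
theorem tsum_split_three {X : ℕ → ℂ} (hX : Summable X) (hX0 : X 0 = 0) {p₂ p₃ : ℕ → ℝ}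
    {N₁ N₂ : ℕ} (h1 : ∀ n, n ≤ N₁ → p₂ n = 0 ∧ p₃ n = 0) (h2 : ∀ n, N₁ < n → p₂ n + p₃ n = 1)
    (h3 : ∀ n, N₂ < n → p₂ n = 0) (hp3 : ∀ n, |p₃ n| ≤ 1) :
    (Summable fun n => (p₃ n : ℂ) * X n) ∧
    ∑' n, X n = (∑ n ∈ Finset.Icc 1 N₁, X n) + (∑ n ∈ Finset.Icc 1 N₂, (p₂ n : ℂ) * X n) +
      ∑' n, (p₃ n : ℂ) * X n := by
  classical
  -- the three pieces
  set X₁ : ℕ → ℂ := fun n => if n ≤ N₁ then X n else 0 with hX₁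
  set X₂ : ℕ → ℂ := fun n => (p₂ n : ℂ) * X n with hX₂
  set X₃ : ℕ → ℂ := fun n => (p₃ n : ℂ) * X n with hX₃
  have hsum3 : Summable X₃ := by
    refine Summable.of_norm_bounded hX.norm (fun n => ?_)
    rw [hX₃, norm_mul, Complex.norm_real, Real.norm_eq_abs]
    calc |p₃ n| * ‖X n‖ ≤ 1 * ‖X n‖ := by gcongr; exact hp3 n
      _ = ‖X n‖ := one_mul _
  have hpt : ∀ n, X n = X₁ n + X₂ n + X₃ n := by
    intro n
    simp only [hX₁, hX₂, hX₃]
    by_cases hn : n ≤ N₁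
    · rw [if_pos hn, (h1 n hn).1, (h1 n hn).2]; push_cast; ring
    · rw [if_neg hn]
      have h := h2 n (not_le.mp hn)
      have : (p₂ n : ℂ) + (p₃ n : ℂ) = 1 := by exact_mod_cast h
      linear_combination (-(X n)) * this
  have hfin1 : ∀ n, N₁ < n → X₁ n = 0 := fun n hn => by simp [hX₁, not_le.mpr hn]
  have hfin2 : ∀ n, N₂ < n → X₂ n = 0 := fun n hn => by simp [hX₂, h3 n hn]
  have hs1 : Summable X₁ := summable_of_ne_finset_zero (s := Finset.Icc 0 N₁) fun n hn => by
    rw [Finset.mem_Icc, not_and_or] at hn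
    rcases hn with h | h
    · exact absurd (Nat.zero_le n) h
    · exact hfin1 n (not_le.mp h)
  have hs2 : Summable X₂ := summable_of_ne_finset_zero (s := Finset.Icc 0 N₂) fun n hn => by
    rw [Finset.mem_Icc, not_and_or] at hn
    rcases hn with h | h
    · exact absurd (Nat.zero_le n) h
    · exact hfin2 n (not_le.mp h)
  refine ⟨hsum3, ?_⟩
  rw [tsum_congr hpt, Summable.tsum_add (hs1.add hs2) hsum3, Summable.tsum_add hs1 hs2,
    tsum_eq_sum_Icc_of_support (f := X₁) (by simp [hX₁, hX0]) hfin1,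
    tsum_eq_sum_Icc_of_support (f := X₂) (by simp [hX₂, hX0]) hfin2]
  congr 2
  refine Finset.sum_congr rfl fun n hn => ?_
  rw [Finset.mem_Icc] at hn
  simp [hX₁, hn.2]

/-- The partition functions of §8: `p₂(n) = 𝟙_{n > q⁴}(1 − η(n/T − 1))`, `p₃(n) = η(n/T − 1)`
(`η = Real.smoothTransition`) satisfy the hypotheses of `tsum_split_three` with `N₁ = q⁴ ≤ T`,
`N₂ = ⌊2T⌋₊`. [cite: ConreyIwaniec2002, §8 (8.5)–(8.7)] -/
theorem partition_facts {q : ℕ} {T : ℝ} (hT : 0 < T) (hqT : ((q ^ 4 : ℕ) : ℝ) ≤ T) :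
    (∀ n : ℕ, n ≤ q ^ 4 →
      (if q ^ 4 < n then 1 - Real.smoothTransition (n / T - 1) else 0) = 0 ∧
        Real.smoothTransition ((n : ℝ) / T - 1) = 0) ∧
    (∀ n : ℕ, q ^ 4 < n →
      (if q ^ 4 < n then 1 - Real.smoothTransition (n / T - 1) else 0) +
        Real.smoothTransition ((n : ℝ) / T - 1) = 1) ∧
    (∀ n : ℕ, ⌊2 * T⌋₊ < n → (if q ^ 4 < n then 1 - Real.smoothTransition (n / T - 1) else 0) = 0) ∧
    (∀ n : ℕ, |Real.smoothTransition ((n : ℝ) / T - 1)| ≤ 1) := by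
  refine ⟨fun n hn => ⟨by rw [if_neg (not_lt.mpr hn)], ?_⟩, fun n hn => by rw [if_pos hn]; ring,
    fun n hn => ?_, fun n => ?_⟩
  · apply Real.smoothTransition.zero_of_nonpos
    have : (n : ℝ) ≤ T := le_trans (by exact_mod_cast hn) hqT
    rw [sub_nonpos, div_le_one hT]; exact this
  · split_ifs with h
    · rw [Real.smoothTransition.one_of_one_le, sub_self]
      have h2 : 2 * T < n := lt_of_lt_of_le (Nat.lt_floor_add_one (2 * T)) (by exact_mod_cast hn)
      rw [le_sub_iff_add_le, le_div_iff₀ hT]; linarith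
    · rfl
  · rw [abs_of_nonneg (Real.smoothTransition.nonneg _)]
    exact Real.smoothTransition.le_one _

/-! ## §4. The pieces in the shape of the weighted mean-value theorems -/

/-- `log n ∈ [0, log N]` for `1 ≤ n ≤ N`. [cite: ConreyIwaniec2002, §8 (8.5)] -/
theorem log_mem_Icc_of_mem_Icc {n N : ℕ} (hn : n ∈ Finset.Icc 1 N) :
    Real.log n ∈ Set.Icc 0 (Real.log N) := by
  rw [Finset.mem_Icc] at hn
  have h1 : (1 : ℝ) ≤ n := by exact_mod_cast hn.1
  exact ⟨Real.log_nonneg h1, Real.log_le_log (by linarith) (by exact_mod_cast hn.2)⟩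

/-- The long-range bookkeeping at `u = log n`: `a(n)·(1 + n/qT)⁴/c₀ = η(n/T − 1)` and the
half-window `Θ₃(log n) = 1` wherever `a(n) ≠ 0`; precisely, for `n ≥ 1`, `c₀ ≠ 0`, `q T > 0`,
`(a(n) : ℂ)·Θ₃(log n)·((1 + e^{log n}/qT)⁴/c₀) = η(n/T − 1)`.
[cite: ConreyIwaniec2002, §8 (8.7)] -/
theorem tailCutoff_mul_window_mul_P {c₀ T : ℝ} {q : ℕ} (hc₀ : c₀ ≠ 0) (hT : 0 < T)
    (hqT : 0 < (q : ℝ) * T) {Θ₃ : ℝ → ℝ} (hΘ₃ : ∀ u, Real.log T ≤ u → Θ₃ u = 1)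
    {n : ℕ} (hn : n ≠ 0) :
    (tailCutoff c₀ q T n : ℂ) * ((Θ₃ (Real.log n) : ℂ) *
        ((((1 + Real.exp (Real.log n) / (q * T)) ^ 4 / c₀ : ℝ)) : ℂ)) =
      ((Real.smoothTransition ((n : ℝ) / T - 1) : ℝ) : ℂ) := by
  have hn0 : (0 : ℝ) < n := by exact_mod_cast Nat.pos_of_ne_zero hn
  have hreal : tailCutoff c₀ q T n * (Θ₃ (Real.log n) *
      ((1 + Real.exp (Real.log n) / (q * T)) ^ 4 / c₀)) = Real.smoothTransition ((n : ℝ) / T - 1) := by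
    rw [Real.exp_log hn0]
    rcases le_or_gt (n : ℝ) T with hle | hgt
    · rw [tailCutoff_of_le hT hle, Real.smoothTransition.zero_of_nonpos (by
        rw [sub_nonpos, div_le_one hT]; exact hle), zero_mul]
    · rw [hΘ₃ _ (Real.log_le_log hT hgt.le), one_mul, tailCutoff]
      have hr : (1 + (n : ℝ) / (q * T)) ≠ 0 := by positivity
      field_simp
  rw [← Complex.ofReal_mul, ← Complex.ofReal_mul, hreal]

/-- **(8.5) split into the three ranges, in mean-value shape.** For `s = ½+it`, `s′ = ½+it′`
(`|t| ≥ 2`, `0 < |t−t′| ≤ 1`), `q⁴ ≤ T`, windows `Θ₁ = 1` on `[0, log q⁴]`, `Θ₂ = 1` on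
`[0, log 2T]`, `Θ₃ = 1` on `[log T, ∞)`, and the tail cut-off `a = tailCutoff c₀ q T`:
`B(s) = Σ_{n≤q⁴} a¹_n ω¹(log n) n^{−it} + Σ_{n≤⌊2T⌋} a²_n ω²(log n) n^{−it} + Σ' a³_n ω³(log n)n^{−it}`
with `a¹_n = λ(n)n^{−1/2}`, `a²_n = a¹_n·𝟙_{n>q⁴}(1 − η(n/T−1))`, `a³_n = a(n)λ(n)n^{−1/2}`,
`ω¹ = Θ₁Ω`, `ω² = Θ₂Ω`, `ω³ = Θ₃Ω(1+e^u/qT)⁴/c₀`. [cite: ConreyIwaniec2002, §8 (8.5)–(8.7)] -/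
theorem afeA_dividedDiff_split {q : ℕ} [NeZero q] (hq4 : 4 < q) {χ : DirichletCharacter ℂ q}
    (hprim : χ.IsPrimitive) (hquad : χ.IsQuadratic) (hodd : χ.Odd)
    (K : Type) [Field K] [NumberField K] (h2 : Module.finrank ℚ K = 2)
    (hdisc : NumberField.discr K = -(q : ℤ)) (ψ : ClassGroup (𝓞 K) →* ℂˣ)
    {T c₀ : ℝ} (hT : 0 < T) (hqT : ((q ^ 4 : ℕ) : ℝ) ≤ T) (hc₀ : c₀ ≠ 0)
    {Θ₁ Θ₂ Θ₃ : ℝ → ℝ} (hΘ₁ : ∀ u ∈ Set.Icc 0 (Real.log ((q ^ 4 : ℕ) : ℝ)), Θ₁ u = 1)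
    (hΘ₂ : ∀ u ∈ Set.Icc 0 (Real.log ((⌊2 * T⌋₊ : ℕ) : ℝ)), Θ₂ u = 1)
    (hΘ₃ : ∀ u, Real.log T ≤ u → Θ₃ u = 1)
    {t t' : ℝ} (ht : 2 ≤ |t|) (htt' : t' ≠ t) (hdist : |t' - t| ≤ 1) :
    (afeA K ψ q (1 / 2 + t * I) - afeA K ψ q (1 / 2 + t' * I)) / ((t : ℂ) * I - t' * I) =
      (∑ n ∈ Finset.Icc 1 (q ^ 4),
          (twistCount K (classGroupCharIdealHom ψ) n * (n : ℂ) ^ (-(1 / 2 : ℂ))) *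
            ((Θ₁ (Real.log n) : ℂ) * afeOmega q t t' (Real.log n)) * (n : ℂ) ^ (-((t : ℂ) * I))) +
      (∑ n ∈ Finset.Icc 1 ⌊2 * T⌋₊,
          (twistCount K (classGroupCharIdealHom ψ) n * (n : ℂ) ^ (-(1 / 2 : ℂ)) *
            (((if q ^ 4 < n then 1 - Real.smoothTransition ((n : ℝ) / T - 1) else 0 : ℝ)) : ℂ)) *
            ((Θ₂ (Real.log n) : ℂ) * afeOmega q t t' (Real.log n)) * (n : ℂ) ^ (-((t : ℂ) * I))) +
      ∑' n : ℕ, ((tailCutoff c₀ q T n : ℂ) * twistCount K (classGroupCharIdealHom ψ) n *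
            (n : ℂ) ^ (-(1 / 2 : ℂ))) *
          ((Θ₃ (Real.log n) : ℂ) * (afeOmega q t t' (Real.log n) *
            (((1 + Real.exp (Real.log n) / (q * T)) ^ 4 / c₀ : ℝ) : ℂ))) *
          (n : ℂ) ^ (-((t : ℂ) * I)) := by
  have hq0 : (0 : ℝ) < q := by exact_mod_cast (show 0 < q by omega)
  have hqT' : 0 < (q : ℝ) * T := mul_pos hq0 hT
  obtain ⟨hsum, hB⟩ := afeA_dividedDiff_eq_tsum hq4 hprim hquad hodd K h2 hdisc ψ ht htt' hdist
  obtain ⟨p1, p2, p3, p4⟩ := partition_facts (q := q) hT hqT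
  set X : ℕ → ℂ := fun n => twistCount K (classGroupCharIdealHom ψ) n * (n : ℂ) ^ (-(1 / 2 : ℂ)) *
    afeOmega q t t' (Real.log n) * (n : ℂ) ^ (-((t : ℂ) * I)) with hX
  have hX0 : X 0 = 0 := by simp [hX, twistCount_zero]
  obtain ⟨-, hsplit⟩ := tsum_split_three hsum hX0 p1 p2 p3 p4
  rw [hB, hsplit]
  congr 1
  · congr 1
    · refine Finset.sum_congr rfl fun n hn => ?_
      rw [hΘ₁ _ (log_mem_Icc_of_mem_Icc hn)]
      push_cast; ring
    · refine Finset.sum_congr rfl fun n hn => ?_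
      rw [hΘ₂ _ (log_mem_Icc_of_mem_Icc hn)]
      push_cast; ring
  · refine tsum_congr fun n => ?_
    rcases eq_or_ne n 0 with rfl | hn
    · simp [hX, twistCount_zero]
    have key := tailCutoff_mul_window_mul_P hc₀ hT hqT' hΘ₃ hn
    calc ((Real.smoothTransition ((n : ℝ) / T - 1) : ℝ) : ℂ) * X n
        = (tailCutoff c₀ q T n : ℂ) * ((Θ₃ (Real.log n) : ℂ) *
            ((((1 + Real.exp (Real.log n) / (q * T)) ^ 4 / c₀ : ℝ)) : ℂ)) * X n := by rw [key]
      _ = _ := by rw [hX]; ring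

/-- **(8.8)–(8.9) split into the three ranges, in mean-value shape**: with the data of
`afeA_dividedDiff_split` and `N(s) = Σ_{n≤q⁴} λ(n)n^{−s}` (`shortLSum`),
`A(s) − N(s) = Σ_{n≤q⁴} a¹_n Θ₁(V_s − 1)(log n) n^{−it} + Σ_{n≤⌊2T⌋} a²_n (Θ₂V_s)(log n) n^{−it}
  + Σ' a³_n (Θ₃V_s(1+e^u/qT)⁴/c₀)(log n) n^{−it}`. [cite: ConreyIwaniec2002, §8 (8.8)–(8.9)] -/
theorem afeA_sub_shortLSum_split {q : ℕ} [NeZero q] (hq4 : 4 < q) {χ : DirichletCharacter ℂ q}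
    (hprim : χ.IsPrimitive) (hquad : χ.IsQuadratic) (hodd : χ.Odd)
    (K : Type) [Field K] [NumberField K] (h2 : Module.finrank ℚ K = 2)
    (hdisc : NumberField.discr K = -(q : ℤ)) (ψ : ClassGroup (𝓞 K) →* ℂˣ)
    {T c₀ : ℝ} (hT : 0 < T) (hqT : ((q ^ 4 : ℕ) : ℝ) ≤ T) (hc₀ : c₀ ≠ 0)
    {Θ₁ Θ₂ Θ₃ : ℝ → ℝ} (hΘ₁ : ∀ u ∈ Set.Icc 0 (Real.log ((q ^ 4 : ℕ) : ℝ)), Θ₁ u = 1)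
    (hΘ₂ : ∀ u ∈ Set.Icc 0 (Real.log ((⌊2 * T⌋₊ : ℕ) : ℝ)), Θ₂ u = 1)
    (hΘ₃ : ∀ u, Real.log T ≤ u → Θ₃ u = 1)
    {t : ℝ} (ht : 1 ≤ |t|) :
    afeA K ψ q (1 / 2 + t * I) - shortLSum K ψ q (1 / 2 + t * I) =
      (∑ n ∈ Finset.Icc 1 (q ^ 4),
          (twistCount K (classGroupCharIdealHom ψ) n * (n : ℂ) ^ (-(1 / 2 : ℂ))) *
            ((Θ₁ (Real.log n) : ℂ) * (afeVlog q (1 / 2 + t * I) (Real.log n) - 1)) *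
            (n : ℂ) ^ (-((t : ℂ) * I))) +
      (∑ n ∈ Finset.Icc 1 ⌊2 * T⌋₊,
          (twistCount K (classGroupCharIdealHom ψ) n * (n : ℂ) ^ (-(1 / 2 : ℂ)) *
            (((if q ^ 4 < n then 1 - Real.smoothTransition ((n : ℝ) / T - 1) else 0 : ℝ)) : ℂ)) *
            ((Θ₂ (Real.log n) : ℂ) * afeVlog q (1 / 2 + t * I) (Real.log n)) *
            (n : ℂ) ^ (-((t : ℂ) * I))) +
      ∑' n : ℕ, ((tailCutoff c₀ q T n : ℂ) * twistCount K (classGroupCharIdealHom ψ) n *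
            (n : ℂ) ^ (-(1 / 2 : ℂ))) *
          ((Θ₃ (Real.log n) : ℂ) * (afeVlog q (1 / 2 + t * I) (Real.log n) *
            (((1 + Real.exp (Real.log n) / (q * T)) ^ 4 / c₀ : ℝ) : ℂ))) *
          (n : ℂ) ^ (-((t : ℂ) * I)) := by
  have hq0 : (0 : ℝ) < q := by exact_mod_cast (show 0 < q by omega)
  have hqT' : 0 < (q : ℝ) * T := mul_pos hq0 hT
  set s : ℂ := 1 / 2 + t * I with hs
  have hsum := summable_term_afeA hq4 hprim hquad hodd K h2 hdisc ψ (w := s) (by simp [hs])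
    (by simpa [hs] using ht)
  set lam : ℕ → ℂ := fun n => twistCount K (classGroupCharIdealHom ψ) n with hlam
  have hlam0 : lam 0 = 0 := by simp [hlam, twistCount_zero]
  set X : ℕ → ℂ := fun n => lam n * afeV s (n / condQ q) * (n : ℂ) ^ (-s) with hX
  have hX0 : X 0 = 0 := by simp [hX, hlam0]
  have hsumX : Summable X := by
    refine hsum.congr fun n => ?_
    rw [hX]; exact LSeries.term_def₀ (by simp [twistCount_zero]) s n
  have hA : afeA K ψ q s = ∑' n, X n := afeA_eq_tsum K ψ q s
  obtain ⟨p1, p2, p3, p4⟩ := partition_facts (q := q) hT hqT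
  obtain ⟨-, hsplit⟩ := tsum_split_three hsumX hX0 p1 p2 p3 p4
  -- `n^{-s} = n^{-1/2} n^{-it}` and `V_s(n/Q) = afeVlog q s (log n)`
  have hcpow : ∀ n : ℕ, n ≠ 0 → (n : ℂ) ^ (-s) = (n : ℂ) ^ (-(1 / 2 : ℂ)) * (n : ℂ) ^ (-((t : ℂ) * I)) := by
    intro n hn
    rw [hs, neg_add, Complex.cpow_add _ _ (by exact_mod_cast hn)]
  have hXn : ∀ n : ℕ, n ≠ 0 → X n = lam n * (n : ℂ) ^ (-(1 / 2 : ℂ)) *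
      afeVlog q s (Real.log n) * (n : ℂ) ^ (-((t : ℂ) * I)) := by
    intro n hn
    rw [hX]; simp only
    rw [hcpow n hn, afeVlog_log _ hn]; ring
  rw [hA, hsplit, shortLSum]
  have hN : ∑ n ∈ Finset.Icc 1 (q ^ 4), lam n * (n : ℂ) ^ (-s) =
      ∑ n ∈ Finset.Icc 1 (q ^ 4), lam n * (n : ℂ) ^ (-(1 / 2 : ℂ)) * (n : ℂ) ^ (-((t : ℂ) * I)) := by
    refine Finset.sum_congr rfl fun n hn => ?_
    rw [hcpow n (by rw [Finset.mem_Icc] at hn; omega)]; ring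
  rw [hN]
  have e1 : ∑ n ∈ Finset.Icc 1 (q ^ 4), X n - ∑ n ∈ Finset.Icc 1 (q ^ 4),
      lam n * (n : ℂ) ^ (-(1 / 2 : ℂ)) * (n : ℂ) ^ (-((t : ℂ) * I)) =
      ∑ n ∈ Finset.Icc 1 (q ^ 4), (lam n * (n : ℂ) ^ (-(1 / 2 : ℂ))) *
        ((Θ₁ (Real.log n) : ℂ) * (afeVlog q s (Real.log n) - 1)) * (n : ℂ) ^ (-((t : ℂ) * I)) := by
    rw [← Finset.sum_sub_distrib]
    refine Finset.sum_congr rfl fun n hn => ?_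
    rw [hΘ₁ _ (log_mem_Icc_of_mem_Icc hn), hXn n (by rw [Finset.mem_Icc] at hn; omega)]
    push_cast; ring
  have e2 : ∑ n ∈ Finset.Icc 1 ⌊2 * T⌋₊,
      (((if q ^ 4 < n then 1 - Real.smoothTransition ((n : ℝ) / T - 1) else 0 : ℝ)) : ℂ) * X n =
      ∑ n ∈ Finset.Icc 1 ⌊2 * T⌋₊, (lam n * (n : ℂ) ^ (-(1 / 2 : ℂ)) *
        (((if q ^ 4 < n then 1 - Real.smoothTransition ((n : ℝ) / T - 1) else 0 : ℝ)) : ℂ)) *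
        ((Θ₂ (Real.log n) : ℂ) * afeVlog q s (Real.log n)) * (n : ℂ) ^ (-((t : ℂ) * I)) := by
    refine Finset.sum_congr rfl fun n hn => ?_
    rw [hΘ₂ _ (log_mem_Icc_of_mem_Icc hn), hXn n (by rw [Finset.mem_Icc] at hn; omega)]
    push_cast; ring
  have e3 : ∑' n : ℕ, ((Real.smoothTransition ((n : ℝ) / T - 1) : ℝ) : ℂ) * X n =
      ∑' n : ℕ, ((tailCutoff c₀ q T n : ℂ) * lam n * (n : ℂ) ^ (-(1 / 2 : ℂ))) *
        ((Θ₃ (Real.log n) : ℂ) * (afeVlog q s (Real.log n) *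
          (((1 + Real.exp (Real.log n) / (q * T)) ^ 4 / c₀ : ℝ) : ℂ))) * (n : ℂ) ^ (-((t : ℂ) * I)) := by
    refine tsum_congr fun n => ?_
    rcases eq_or_ne n 0 with rfl | hn
    · simp [hX0, hlam0]
    have key := tailCutoff_mul_window_mul_P hc₀ hT hqT' hΘ₃ hn
    rw [hXn n hn]
    calc ((Real.smoothTransition ((n : ℝ) / T - 1) : ℝ) : ℂ) *
          (lam n * (n : ℂ) ^ (-(1 / 2 : ℂ)) * afeVlog q s (Real.log n) * (n : ℂ) ^ (-((t : ℂ) * I)))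
        = (tailCutoff c₀ q T n : ℂ) * ((Θ₃ (Real.log n) : ℂ) *
            ((((1 + Real.exp (Real.log n) / (q * T)) ^ 4 / c₀ : ℝ)) : ℂ)) *
          (lam n * (n : ℂ) ^ (-(1 / 2 : ℂ)) * afeVlog q s (Real.log n) * (n : ℂ) ^ (-((t : ℂ) * I))) := by
          rw [key]
      _ = _ := by ring
  rw [← e1, e2, e3]
  ring

/-! ## §5. The long-range coefficients `a_n = a(n)λ(n)n^{−1/2}` -/

/-- `|a(n)| ≤ c₀ (qT)⁴ n^{−4}` for the tail cut-off (`n ≥ 1`, `c₀ ≥ 0`).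
[cite: ConreyIwaniec2002, §8 (8.7), Corollary 6.2 (6.38)] -/
theorem abs_tailCutoff_le {c₀ T : ℝ} {q : ℕ} (hc₀ : 0 ≤ c₀) (hqT : 0 < (q : ℝ) * T) {n : ℕ}
    (hn : n ≠ 0) : |tailCutoff c₀ q T n| ≤ c₀ * (((q : ℝ) * T) ^ 4 * ((n : ℝ) ^ 4)⁻¹) := by
  have hn0 : (0 : ℝ) < n := by exact_mod_cast Nat.pos_of_ne_zero hn
  have hr : 0 < 1 + (n : ℝ) / (q * T) := by positivity
  obtain ⟨h0, h1⟩ := tailCutoff_nonneg_le (c₀ := c₀) (q := (q : ℝ)) (T := T) (y := (n : ℝ)) hc₀ hr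
  rw [abs_of_nonneg h0]
  refine h1.trans ?_
  gcongr
  rw [inv_pow, ← inv_pow, ← div_eq_mul_inv, ← div_pow]
  apply pow_le_pow_left₀ (inv_nonneg.mpr hr.le)
  rw [inv_le_comm₀ hr (by positivity), inv_div]
  have : (n : ℝ) / (q * T) ≤ 1 + (n : ℝ) / (q * T) := by linarith
  exact this

/-- **The long-range coefficients are absolutely summable**: `Σ |a(n)λ(n)n^{−1/2}| < ∞`.
[cite: ConreyIwaniec2002, §8 (8.7)] -/
theorem tail_coeff_summable {q : ℕ} [NeZero q] (hq4 : 4 < q) {χ : DirichletCharacter ℂ q}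
    (hprim : χ.IsPrimitive) (hquad : χ.IsQuadratic) (hodd : χ.Odd)
    (K : Type) [Field K] [NumberField K] (h2 : Module.finrank ℚ K = 2)
    (hdisc : NumberField.discr K = -(q : ℤ)) (ψ : ClassGroup (𝓞 K) →* ℂˣ)
    {T c₀ : ℝ} (hT : 0 < T) (hc₀ : 0 ≤ c₀) :
    Summable fun n : ℕ => ‖(tailCutoff c₀ q T n : ℂ) * twistCount K (classGroupCharIdealHom ψ) n *
      (n : ℂ) ^ (-(1 / 2 : ℂ))‖ := by
  have hq0 : (0 : ℝ) < q := by exact_mod_cast (show 0 < q by omega)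
  have hqT : 0 < (q : ℝ) * T := mul_pos hq0 hT
  have hlam := norm_twistCount_le_card_divisors hprim hquad hodd K h2 hdisc ψ
  refine Summable.of_nonneg_of_le (fun n => norm_nonneg _) (fun n => ?_)
    ((ZetaM4D.summable_card_divisors_mul_rpow (by norm_num : (1 : ℝ) < 9 / 2)).mul_left
      (c₀ * ((q : ℝ) * T) ^ 4))
  rcases eq_or_ne n 0 with rfl | hn
  · simp [twistCount_zero]
  have hn0 : (0 : ℝ) < n := by exact_mod_cast Nat.pos_of_ne_zero hn
  rw [norm_mul, norm_mul, Complex.norm_real, Real.norm_eq_abs,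
    Complex.norm_natCast_cpow_of_pos (Nat.pos_of_ne_zero hn)]
  simp only [neg_re, one_div]
  rw [show ((2 : ℂ)⁻¹).re = (1 / 2 : ℝ) by simp]
  have h1 := abs_tailCutoff_le hc₀ hqT hn
  have hrpow : ((n : ℝ) ^ 4)⁻¹ * (n : ℝ) ^ (-(1 / 2 : ℝ)) = (n : ℝ) ^ (-(9 / 2 : ℝ)) := by
    rw [show ((n : ℝ) ^ 4)⁻¹ = (n : ℝ) ^ (-(4 : ℝ)) by
      rw [Real.rpow_neg hn0.le, ← Real.rpow_natCast _ 4]; norm_num, ← Real.rpow_add hn0]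
    norm_num
  calc |tailCutoff c₀ q T n| * ‖twistCount K (classGroupCharIdealHom ψ) n‖ * (n : ℝ) ^ (-(1 / 2 : ℝ))
      ≤ c₀ * (((q : ℝ) * T) ^ 4 * ((n : ℝ) ^ 4)⁻¹) * n.divisors.card * (n : ℝ) ^ (-(1 / 2 : ℝ)) := by
        gcongr
        exact hlam n
    _ = c₀ * ((q : ℝ) * T) ^ 4 * ((n.divisors.card : ℝ) *
          (((n : ℝ) ^ 4)⁻¹ * (n : ℝ) ^ (-(1 / 2 : ℝ)))) := by ring
    _ = _ := by rw [hrpow]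

/-- **The error term of Proposition 5.4 for the long range**:
`(1 + n/T)|a_n|² ≤ (2c₀²/T)·(1 + n/qT)^{−8} d(n)²` termwise (`a = 0` on `n ≤ T`, `(1+n/T)/n ≤ 2/T`
on `n > T`), hence `Σ_n (1 + n/T)|a_n|² ≤ (2c₀²/T) Σ_n (1+n/qT)^{−8}d(n)²` whenever the latter
converges. [cite: ConreyIwaniec2002, §8 (8.7), Proposition 5.4 (5.15)] -/
theorem tail_coeff_sq_summable_le {q : ℕ} [NeZero q] (hq4 : 4 < q) {χ : DirichletCharacter ℂ q}
    (hprim : χ.IsPrimitive) (hquad : χ.IsQuadratic) (hodd : χ.Odd)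
    (K : Type) [Field K] [NumberField K] (h2 : Module.finrank ℚ K = 2)
    (hdisc : NumberField.discr K = -(q : ℤ)) (ψ : ClassGroup (𝓞 K) →* ℂˣ)
    {T c₀ : ℝ} (hT : 0 < T) (hc₀ : 0 ≤ c₀)
    (hdiv : Summable fun n : ℕ => ((1 + (n : ℝ) / (q * T)) ^ 8)⁻¹ * (n.divisors.card : ℝ) ^ 2) :
    (Summable fun n : ℕ => (1 + n / T) *
      ‖(tailCutoff c₀ q T n : ℂ) * twistCount K (classGroupCharIdealHom ψ) n *
        (n : ℂ) ^ (-(1 / 2 : ℂ))‖ ^ 2) ∧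
    ∑' n : ℕ, (1 + n / T) *
      ‖(tailCutoff c₀ q T n : ℂ) * twistCount K (classGroupCharIdealHom ψ) n *
        (n : ℂ) ^ (-(1 / 2 : ℂ))‖ ^ 2 ≤
      2 * c₀ ^ 2 / T * ∑' n : ℕ, ((1 + (n : ℝ) / (q * T)) ^ 8)⁻¹ * (n.divisors.card : ℝ) ^ 2 := by
  have hq0 : (0 : ℝ) < q := by exact_mod_cast (show 0 < q by omega)
  have hqT : 0 < (q : ℝ) * T := mul_pos hq0 hT
  have hlam := norm_twistCount_le_card_divisors hprim hquad hodd K h2 hdisc ψ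
  have hpt : ∀ n : ℕ, (1 + n / T) *
      ‖(tailCutoff c₀ q T n : ℂ) * twistCount K (classGroupCharIdealHom ψ) n *
        (n : ℂ) ^ (-(1 / 2 : ℂ))‖ ^ 2 ≤
      2 * c₀ ^ 2 / T * (((1 + (n : ℝ) / (q * T)) ^ 8)⁻¹ * (n.divisors.card : ℝ) ^ 2) := by
    intro n
    rcases eq_or_ne n 0 with rfl | hn
    · simp [twistCount_zero]
    have hn0 : (0 : ℝ) < n := by exact_mod_cast Nat.pos_of_ne_zero hn
    rcases le_or_gt (n : ℝ) T with hle | hgt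
    · rw [tailCutoff_of_le hT hle]; simp; positivity
    rw [norm_mul, norm_mul, Complex.norm_real, Real.norm_eq_abs,
      Complex.norm_natCast_cpow_of_pos (Nat.pos_of_ne_zero hn)]
    simp only [neg_re, one_div]
    rw [show ((2 : ℂ)⁻¹).re = (1 / 2 : ℝ) by simp]
    have hr : 0 < 1 + (n : ℝ) / (q * T) := by positivity
    obtain ⟨h0, h1⟩ := tailCutoff_nonneg_le (c₀ := c₀) (q := (q : ℝ)) (T := T) (y := (n : ℝ)) hc₀ hr
    rw [abs_of_nonneg h0]
    have hsq : ((n : ℝ) ^ (-(1 / 2 : ℝ))) ^ 2 = (n : ℝ)⁻¹ := by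
      rw [← Real.rpow_natCast, ← Real.rpow_mul hn0.le]; norm_num
      exact Real.rpow_neg_one (n : ℝ)
    have htc2 : (tailCutoff c₀ q T n) ^ 2 ≤ c₀ ^ 2 * ((1 + (n : ℝ) / (q * T)) ^ 8)⁻¹ := by
      calc (tailCutoff c₀ q T n) ^ 2 ≤ (c₀ * ((1 + (n : ℝ) / (q * T))⁻¹) ^ 4) ^ 2 :=
            pow_le_pow_left₀ h0 h1 2
        _ = c₀ ^ 2 * ((1 + (n : ℝ) / (q * T)) ^ 8)⁻¹ := by rw [mul_pow, ← pow_mul, inv_pow]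
    have hl2 : ‖twistCount K (classGroupCharIdealHom ψ) n‖ ^ 2 ≤ (n.divisors.card : ℝ) ^ 2 :=
      pow_le_pow_left₀ (norm_nonneg _) (hlam n) 2
    have hfrac : (1 + (n : ℝ) / T) * (n : ℝ)⁻¹ ≤ 2 / T := by
      rw [add_mul, div_mul_eq_mul_div, mul_inv_cancel₀ hn0.ne', one_mul]
      have : (n : ℝ)⁻¹ ≤ 1 / T := by rw [one_div]; exact inv_anti₀ hT hgt.le
      have h2 : (2 : ℝ) / T = 2 * (1 / T) := by ring
      linarith
    calc (1 + (n : ℝ) / T) * (tailCutoff c₀ q T n * ‖twistCount K (classGroupCharIdealHom ψ) n‖ *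
          (n : ℝ) ^ (-(1 / 2 : ℝ))) ^ 2
        = ((1 + (n : ℝ) / T) * (n : ℝ)⁻¹) * ((tailCutoff c₀ q T n) ^ 2 *
            ‖twistCount K (classGroupCharIdealHom ψ) n‖ ^ 2) := by
          rw [mul_pow, mul_pow, hsq]; ring
      _ ≤ (2 / T) * ((c₀ ^ 2 * ((1 + (n : ℝ) / (q * T)) ^ 8)⁻¹) * (n.divisors.card : ℝ) ^ 2) := by
          gcongr
      _ = _ := by ring
  have hs : Summable fun n : ℕ => (1 + n / T) *
      ‖(tailCutoff c₀ q T n : ℂ) * twistCount K (classGroupCharIdealHom ψ) n *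
        (n : ℂ) ^ (-(1 / 2 : ℂ))‖ ^ 2 :=
    Summable.of_nonneg_of_le (fun n => by positivity) hpt (hdiv.mul_left _)
  refine ⟨hs, ?_⟩
  calc _ ≤ ∑' n : ℕ, 2 * c₀ ^ 2 / T * (((1 + (n : ℝ) / (q * T)) ^ 8)⁻¹ * (n.divisors.card : ℝ) ^ 2) :=
        hs.tsum_le_tsum hpt (hdiv.mul_left _)
    _ = _ := tsum_mul_left

/-- **The main term of Proposition 5.4 for the long range is the `L`-series of Proposition 6.4**:
`Σ_n a_n n^{−iτ} = Σ_n a(n)λ(n) n^{−(1/2+iτ)}`. [cite: ConreyIwaniec2002, §8 (8.7), Proposition 6.4] -/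
theorem tsum_tail_coeff_cpow_eq_LSeries (K : Type) [Field K] [NumberField K]
    (ψ : ClassGroup (𝓞 K) →* ℂˣ) (q : ℕ) (c₀ T τ : ℝ) :
    ∑' n : ℕ, (tailCutoff c₀ q T n : ℂ) * twistCount K (classGroupCharIdealHom ψ) n *
        (n : ℂ) ^ (-(1 / 2 : ℂ)) * (n : ℂ) ^ (-((τ : ℂ) * I)) =
      LSeries (fun n => (tailCutoff c₀ q T n : ℂ) * twistCount K (classGroupCharIdealHom ψ) n)
        (1 / 2 + τ * I) := by
  unfold LSeries
  refine tsum_congr fun n => ?_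
  rw [LSeries.term_def₀ (by simp [twistCount_zero])]
  rcases eq_or_ne n 0 with rfl | hn
  · simp [twistCount_zero]
  rw [neg_add, Complex.cpow_add _ _ (by exact_mod_cast hn)]
  ring

end ConreyIwaniec2002

end Literature.NumberTheory.LFunctions
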